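import Literature.AnabelianGeometry.SemiGraphs.TemperedCompactInVerticialFinite
import Literature.AnabelianGeometry.SemiGraphs.WitnessIwahoriBundle
import HarnessLib

/-!
# [SemiAnbd] Thm 3.7 (iii)/(iv) non-vacuously, at a graph WITH an estranged edge (witness application)

Mochizuki, *Semi-graphs of anabelioids*, Publ. RIMS **42** (2006) [MochizukiSemiAnbd2006], Thm. 3.7 (iii)/(iv)
pp. 40–41.

Proof-only WITNESS APPLICATION (seat abc-iut-L3-t8 gen 4, after row (β)-ASM): the cell's witness `𝒢₁`
(`IwahoriWitness.loopGraph p`: one vertex with an Iwahori-type group, one ESTRANGED loop; seat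
abc-iut-w5-d236, rows WIT-1b) satisfies the hypotheses of Thm. 3.7 (`loopGraph_thm37Hypotheses`) and has a
finite underlying semi-graph (the bouquet with one loop), so the finite-graph closer
`compactInVerticialAt_of_finiteGraph` (`TemperedCompactInVerticialFinite.lean`) applies: Thm. 3.7 (iii),
(iv) and the edge-like residuals hold AT `𝒢₁`, for every chart of `π₁^temp(𝒢₁)` — a non-vacuity instance of
the whole (β) chain in the presence of an edge (the earlier instance `affWitness`, seat abc-iut-w5-d212, is
edgeless and was settled by hand).  Honest limits: `𝒢₁` is a consistency witness for the typed hypothesis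
bundles, not the semi-graph of anabelioids of a curve.  Nothing here bears on [IUTchIII] Cor. 3.12.
-/

namespace Literature.AnabelianGeometry.SemiGraphs

namespace IwahoriWitness

open ProfiniteSemiGraph

variable (p : ℕ) [Fact p.Prime]

/-- The witness graph has finitely many vertices (one). [cite: MochizukiSemiAnbd2006, Thm 3.7 p.40] -/
theorem finite_loopGraph_vertex : Finite (loopGraph p).graph.Vertex :=
  show Finite PUnit from inferInstance

/-- The witness graph has finitely many edges (one). [cite: MochizukiSemiAnbd2006, Thm 3.7 p.40] -/
theorem finite_loopGraph_edge : Finite (loopGraph p).graph.Edge :=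
  show Finite (ULift (Fin 1)) from inferInstance

/-- **Thm. 3.7 (iii) holds at the estranged loop `𝒢₁`** (for every chart and every compact subgroup),
non-vacuously: the hypotheses are witnessed (`loopGraph_thm37Hypotheses`) and the closer of the (β) chain
applies. [cite: MochizukiSemiAnbd2006, Thm 3.7(iii) pp.40-41] -/
theorem compactInVerticialAt_loopGraph : CompactInVerticialAt (loopGraph p) :=
  compactInVerticialAt_of_finiteGraph' (finite_loopGraph_vertex p) (finite_loopGraph_edge p)

/-- Both conjuncts of Thm. 3.7 (iii) at `𝒢₁`, hypotheses discharged: for every chart `c` of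
`π₁^temp(𝒢₁)` and every compact `C ≤ c.G`. [cite: MochizukiSemiAnbd2006, Thm 3.7(iii) pp.40-41] -/
theorem compactInVerticial_loopGraph (c : TemperedPiChart (loopGraph p)) (C : Subgroup c.G)
    (hC : IsCompact (C : Set c.G)) :
    (∃ (v : (loopGraph p).graph.Vertex) (H : Subgroup c.G), H ∈ verticialSubgroups c v ∧ C ≤ H) ∧
      (C ≠ ⊥ → ∀ (v₁ v₂ : (loopGraph p).graph.Vertex) (H₁ H₂ : Subgroup c.G),
        H₁ ∈ verticialSubgroups c v₁ → H₂ ∈ verticialSubgroups c v₂ → H₁ ≠ H₂ → C ≤ H₁ → C ≤ H₂ →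
          (∀ (v₃ : (loopGraph p).graph.Vertex) (H₃ : Subgroup c.G), H₃ ∈ verticialSubgroups c v₃ →
              C ≤ H₃ → H₃ = H₁ ∨ H₃ = H₂) ∧
          ∃ (e : (loopGraph p).graph.Edge) (L : Subgroup c.G), (loopGraph p).graph.IsClosedEdge e ∧
            L ∈ edgeLikeSubgroups c e ∧ C ≤ L) :=
  compactInVerticialAt_loopGraph p (loopGraph_thm37Hypotheses p) c C hC

/-- **Thm. 3.7 (iv) holds at the estranged loop `𝒢₁`** (maximal compact = verticial; nontrivial
intersections of two distinct maximal compact subgroups = edge-like subgroups of closed edges), non-vacuously.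
[cite: MochizukiSemiAnbd2006, Thm 3.7(iv) p.41] -/
theorem maximalCompactIffVerticialAt_loopGraph : MaximalCompactIffVerticialAt (loopGraph p) :=
  haveI := finite_loopGraph_vertex p
  haveI := finite_loopGraph_edge p
  maximalCompactIffVerticialAt_of_finiteGraph

/-- A semi-graph of anabelioids WITH AN EDGE at which Thm. 3.7 (iii) and (iv) hold with all hypotheses
witnessed. [cite: MochizukiSemiAnbd2006, Thm 3.7 pp.40-41] -/
theorem exists_thm37iii_iv_with_edge :
    ∃ 𝒢 : ProfiniteSemiGraph.{0}, Nonempty 𝒢.graph.Edge ∧ 𝒢.Thm37Hypotheses ∧ CompactInVerticialAt 𝒢 ∧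
      MaximalCompactIffVerticialAt 𝒢 :=
  ⟨loopGraph 2, ⟨⟨0⟩⟩, loopGraph_thm37Hypotheses 2, compactInVerticialAt_loopGraph 2,
    maximalCompactIffVerticialAt_loopGraph 2⟩

end IwahoriWitness

end Literature.AnabelianGeometry.SemiGraphs
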